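import Summits.QuantumAdvantage.AdviceFreeQNC0.ResidueAvoidanceWindow
import HarnessLib

/-!
# Cell qa-qnc0 (rung F-Q1, route RingFrame): sparse residue avoidance in the LINEAR regime (`SparseAvoidLinear`, SAL)

Planner qa-qnc0-p1 gen 12 (ROUND-11 §1.4, `Sketch12.SparseAvoidLinear`, ask P16) re-parametrises the
cell's residue-avoidance theorem (`lowDegAvoidMod3Sparse`, crux β's conclusion, jump `q ≈ √(λn)`,
degree `≤ c₁√n`, constant sparsity threshold) to the LINEAR regime: jump `q ≈ n/L`, degree
`d ≤ A·n/L`, sparsity threshold `e^{−κn/L²}`, for every scale `400 ≤ L ≤ B√n`.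

**Theorem SAL** (`sparseAvoidLinear : SparseAvoidLinear`, the Sketch12 statement VERBATIM; constants
`A = c_H/4`, `B = 1/100`, `κ = 110`, `n₀ = n_H` of Srinivasan's lemma).  For `n ≥ n₀`, `400 ≤ L ≤ √n/100`,
every residue `r`, every `d ≤ A·n/L` and every `g ∈ lowDeg 𝔽₂ n d`: if the support of `g` meets the
class `{|u| ≡ r (mod 3)}` in at most `e^{−110·n/L²}·2ⁿ` points, then `#supp g ≤ 2ⁿ/5`.

Proof: the scale-free window bound `card_support_le_window_scale` (`ResidueAvoidanceWindow.lean`) at the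
power of two `q ∈ (n/4L, n/2L]`, with `T := n/L² ≥ 10⁴`, `Λa = T/64`, `Λb = T/16` (so
`Λb·n < q² ≤ 16Λa·n`), `εA = e^{−100T}/1000`, `εB = e^{−T/800}`, `ρ = e^{8T}`, `η = e^{−110T}`:
`#supp g/2ⁿ ≤ 1/2500 + e^{−110T} + e^{−T/800} + 2000·e^{−2T} ≤ 1/5` (`e^{−x} ≤ 1/(1+x)`).
The general characteristic-`2` form is `card_support_le_of_sparse_class_linear`.
The cell's theorem (not in print; Srinivasan's Lemma 3.1 is the engine).  WHAT THIS IS NOT: nothing on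
crux α (`RingToElim`); no separation; the elimination profile `ElimFailProfile` is `EliminationProfile.lean`.

## References

* S. Srinivasan, *A robust version of Hegedűs's lemma, with applications*, TheoretiCS 2 (2023),
  article 5, Lemma 3.1 [Srinivasan2023].
-/

noncomputable section

namespace Summit.QuantumAdvantage.AdviceFreeQNC0

open Finset
open Literature.Computability.MetaComplexity Literature.Computability.MetaComplexity.Smolensky
open Literature.Computability.MetaComplexity.Hegedus

/-- **SAL — sparse residue avoidance, linear regime** (planner qa-qnc0-p1 Sketch12, VERBATIM).  There
are absolute `A, B, κ > 0` and `n₀` such that for all `n ≥ n₀`, every scale parameter `L` with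
`400 ≤ L ≤ B√n`, every residue `r` and every degree `d ≤ A·n/L`: an `𝔽₂`-polynomial `g` of degree `≤ d`
whose support meets the class `{|u| ≡ r (mod 3)}` in at most `e^{-κ n/L²}·2ⁿ` points has support of
size `≤ 2ⁿ/5`. -/
def SparseAvoidLinear : Prop :=
  ∃ A : ℝ, 0 < A ∧ ∃ B : ℝ, 0 < B ∧ ∃ κ : ℝ, 0 < κ ∧ ∃ n₀ : ℕ, ∀ n ≥ n₀, ∀ L : ℕ, 400 ≤ L →
    (L : ℝ) ≤ B * Real.sqrt n → ∀ r d : ℕ, (d : ℝ) ≤ A * n / L →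
      ∀ g : CubeFn (ZMod 2) n, g ∈ lowDeg (ZMod 2) n d →
        ((univ.filter fun u : Fin n → Bool => g u ≠ 0 ∧ Hegedus.wt u % 3 = r % 3).card : ℝ)
            ≤ Real.exp (-(κ * (n : ℝ) / (L : ℝ) ^ 2)) * (2 : ℝ) ^ n →
        ((univ.filter fun u : Fin n → Bool => g u ≠ 0).card : ℝ) ≤ 1 / 5 * (2 : ℝ) ^ n

namespace SparseAvoidLin

/-- The budget of the four terms at `T = n/L² ≥ 10⁴`:
`1/2500 + e^{−110T} + e^{−T/800} + 2000·e^{−2T} ≤ 1/5` (via `e^{−x} ≤ 1/(1+x)`, the tree's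
`Literature.Probability.LatticeModels.SixVertex.exp_neg_le_one_div_add`, re-derived inline to keep the
import closure small). [folklore] -/
theorem budget {T : ℝ} (hT : 10000 ≤ T) :
    1 / 2500 + Real.exp (-(110 * T)) + Real.exp (-(T / 16 / 50)) +
      Real.exp (8 * T) / (Real.exp (-(100 * T)) / 1000) * (2 * Real.exp (-(110 * T))) ≤ 1 / 5 := by
  have exp_neg_le_one_div : ∀ x : ℝ, 0 ≤ x → Real.exp (-x) ≤ 1 / (1 + x) := fun x hx => by
    rw [Real.exp_neg, ← one_div]
    exact one_div_le_one_div_of_le (by linarith) (by linarith [Real.add_one_le_exp x])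
  have hE : Real.exp (8 * T) * Real.exp (-(110 * T)) =
      Real.exp (-(2 * T)) * Real.exp (-(100 * T)) := by
    rw [← Real.exp_add, ← Real.exp_add]
    congr 1
    ring
  have hpos : 0 < Real.exp (-(100 * T)) := Real.exp_pos _
  have h3 : Real.exp (8 * T) / (Real.exp (-(100 * T)) / 1000) * (2 * Real.exp (-(110 * T))) =
      2000 * Real.exp (-(2 * T)) := by
    rw [div_div_eq_mul_div, div_mul_eq_mul_div, div_eq_iff hpos.ne']
    linear_combination 2000 * hE
  have h1 : Real.exp (-(110 * T)) ≤ 1 / 1000 :=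
    (exp_neg_le_one_div _ (by linarith)).trans
      (one_div_le_one_div_of_le (by norm_num) (by linarith))
  have h2 : Real.exp (-(T / 16 / 50)) ≤ 1 / 13 :=
    (exp_neg_le_one_div _ (by positivity)).trans
      (one_div_le_one_div_of_le (by norm_num) (by linarith))
  have h4 : Real.exp (-(2 * T)) ≤ 1 / 20001 :=
    (exp_neg_le_one_div _ (by linarith)).trans
      (one_div_le_one_div_of_le (by norm_num) (by linarith))
  rw [h3]
  norm_num at h1 h2 h4 ⊢
  linarith

end SparseAvoidLin

open SparseAvoidLin

/-- **Sparse residue avoidance in the linear regime, characteristic `2` (any field)**: with `A = c_H/4`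
and `n₀ = n_H` of Srinivasan's lemma, for `n ≥ n₀`, `400 ≤ L ≤ √n/100`, every `r`, every
`d ≤ A·n/L` and every `g ∈ lowDeg F n d`: if `#(supp g ∩ {|u| ≡ r (3)}) ≤ e^{−110 n/L²}·2ⁿ` then
`#supp g ≤ 2ⁿ/5`.  The cell's theorem (qa-qnc0 ROUND-11 §1.4); engine [cite: Srinivasan2023, Lemma 3.1]. -/
theorem card_support_le_of_sparse_class_linear :
    ∃ A : ℝ, 0 < A ∧ ∃ n₀ : ℕ,
      ∀ (F : Type) [Field F] [CharP F 2] [DecidableEq F] (n : ℕ), n₀ ≤ n →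
        ∀ L : ℕ, 400 ≤ L → (L : ℝ) ≤ 1 / 100 * Real.sqrt n →
        ∀ r d : ℕ, (d : ℝ) ≤ A * n / L →
        ∀ g : CubeFn F n, g ∈ lowDeg F n d →
          ((univ.filter fun u : Fin n → Bool => g u ≠ 0 ∧ wt u % 3 = r % 3).card : ℝ) ≤
              Real.exp (-(110 * (n : ℝ) / (L : ℝ) ^ 2)) * (2 : ℝ) ^ n →
          ((univ.filter fun u : Fin n → Bool => g u ≠ 0).card : ℝ) ≤ 1 / 5 * (2 : ℝ) ^ n := by
  classical
  obtain ⟨cH, hcH, nH, hfact⟩ := nzFrac_lt_of_lowDeg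
  refine ⟨cH / 4, by positivity, nH, ?_⟩
  intro F _ _ _ n hn L hL400 hLB r d hd g hg hSr
  have hL0 : 0 < L := by omega
  have hLR : (0 : ℝ) < L := by exact_mod_cast hL0
  have hL400R : (400 : ℝ) ≤ L := by exact_mod_cast hL400
  /- `100 L ≤ √n`, so `n ≥ 10⁴·L²` -/
  have h100L : 100 * (L : ℝ) ≤ Real.sqrt n := by linarith
  have hnR0 : (0 : ℝ) ≤ n := Nat.cast_nonneg _
  have hL2 : (0 : ℝ) < (L : ℝ) ^ 2 := by positivity
  have hnL2 : 10000 * (L : ℝ) ^ 2 ≤ n := by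
    have h1 : (100 * (L : ℝ)) ^ 2 ≤ Real.sqrt n ^ 2 :=
      pow_le_pow_left₀ (by positivity) h100L 2
    rw [Real.sq_sqrt hnR0] at h1
    have e : (100 * (L : ℝ)) ^ 2 = 10000 * (L : ℝ) ^ 2 := by ring
    linarith only [h1, e]
  have hL2' : (4 * L : ℝ) ≤ 10000 * (L : ℝ) ^ 2 := by nlinarith only [hL400R]
  have hnR : (0 : ℝ) < n := by linarith only [hnL2, hL2', hL400R]
  have hn0 : 0 < n := by exact_mod_cast hnR
  /- the scale `q`: a power of two in `(n/4L, n/2L]` -/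
  have h4L : 0 < n / (4 * L) := by
    apply Nat.div_pos _ (by omega)
    have : ((4 * L : ℕ) : ℝ) ≤ n := by push_cast; linarith only [hnL2, hL2']
    exact_mod_cast this
  obtain ⟨j, hmq, hq2m⟩ := exists_pow_two_btwn (n / (4 * L)) h4L
  obtain ⟨q, hq⟩ : ∃ q : ℕ, q = 2 ^ j := ⟨_, rfl⟩
  rw [← hq] at hmq hq2m
  have hdiv : n / (4 * L) * (4 * L) ≤ n := Nat.div_mul_le_self n (4 * L)
  have hlt : n < n / (4 * L) * (4 * L) + 4 * L := Nat.lt_div_mul_add (by omega)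
  have hq2L : q * (2 * L) ≤ n := by
    calc q * (2 * L) ≤ (2 * (n / (4 * L))) * (2 * L) := Nat.mul_le_mul_right _ hq2m
      _ = n / (4 * L) * (4 * L) := by ring
      _ ≤ n := hdiv
  have hq4L : n < q * (4 * L) := by
    calc n < n / (4 * L) * (4 * L) + 4 * L := hlt
      _ = (n / (4 * L) + 1) * (4 * L) := by ring
      _ ≤ q * (4 * L) := Nat.mul_le_mul_right _ (Nat.succ_le_of_lt hmq)
  have h256 : 256 * q ≤ n := by
    calc 256 * q ≤ (2 * L) * q := Nat.mul_le_mul_right _ (by omega)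
      _ = q * (2 * L) := by ring
      _ ≤ n := hq2L
  have hqpos : 0 < q := by rw [hq]; positivity
  have hqR : (0 : ℝ) < q := by exact_mod_cast hqpos
  have hq2LR : (q : ℝ) * (2 * L) ≤ n := by exact_mod_cast hq2L
  have hq4LR : (n : ℝ) < q * (4 * L) := by exact_mod_cast hq4L
  /- degree `d ≤ (c_H/4)·n/L < c_H·q` -/
  have hdq : (d : ℝ) < cH * q := by
    have h1 : cH / 4 * n / L < cH * q := by
      rw [div_lt_iff₀ hLR]
      have h2 := mul_lt_mul_of_pos_left hq4LR hcH
      linarith only [h2]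
    exact lt_of_le_of_lt hd h1
  /- the parameter `T = n/L² ≥ 10⁴` and the bounds `T·n/16 < q² ≤ T·n/4` -/
  obtain ⟨T, hT⟩ : ∃ T : ℝ, T = (n : ℝ) / (L : ℝ) ^ 2 := ⟨_, rfl⟩
  have hTge : 10000 ≤ T := by rw [hT, le_div_iff₀ hL2]; exact hnL2
  have hTn : T * (L : ℝ) ^ 2 = n := by rw [hT]; field_simp
  have hq4 : (q : ℝ) ^ 2 * 4 ≤ T * n := by
    have h1 : ((q : ℝ) * (2 * L)) ^ 2 ≤ (n : ℝ) ^ 2 := pow_le_pow_left₀ (by positivity) hq2LR 2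
    have h2 : ((q : ℝ) ^ 2 * 4) * (L : ℝ) ^ 2 ≤ (T * n) * (L : ℝ) ^ 2 := by
      calc ((q : ℝ) ^ 2 * 4) * (L : ℝ) ^ 2 = ((q : ℝ) * (2 * L)) ^ 2 := by ring
        _ ≤ (n : ℝ) ^ 2 := h1
        _ = (T * (L : ℝ) ^ 2) * n := by rw [hTn]; ring
        _ = (T * n) * (L : ℝ) ^ 2 := by ring
    exact le_of_mul_le_mul_right h2 hL2
  have hq16 : T * n < (q : ℝ) ^ 2 * 16 := by
    have h1 : (n : ℝ) ^ 2 < ((q : ℝ) * (4 * L)) ^ 2 := by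
      have := mul_lt_mul'' hq4LR hq4LR hnR.le hnR.le
      calc (n : ℝ) ^ 2 = (n : ℝ) * n := by ring
        _ < (q : ℝ) * (4 * L) * ((q : ℝ) * (4 * L)) := this
        _ = ((q : ℝ) * (4 * L)) ^ 2 := by ring
    have h2 : (T * n) * (L : ℝ) ^ 2 < ((q : ℝ) ^ 2 * 16) * (L : ℝ) ^ 2 := by
      calc (T * n) * (L : ℝ) ^ 2 = (T * (L : ℝ) ^ 2) * n := by ring
        _ = (n : ℝ) ^ 2 := by rw [hTn]; ring
        _ < ((q : ℝ) * (4 * L)) ^ 2 := h1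
        _ = ((q : ℝ) ^ 2 * 16) * (L : ℝ) ^ 2 := by ring
    exact lt_of_mul_lt_mul_right h2 hL2.le
  have hqq_leR : (q : ℝ) ^ 2 ≤ 16 * (T / 64 * n) := by linarith only [hq4]
  have hLn_ltR : T / 16 * n < (q : ℝ) ^ 2 := by linarith only [hq16]
  /- thresholds -/
  obtain ⟨εA, hεA⟩ : ∃ εA : ℝ, εA = Real.exp (-(100 * T)) / 1000 := ⟨_, rfl⟩
  have hεApos : 0 < εA := by rw [hεA]; positivity
  have hεAexp : εA ≤ Real.exp (-(6400 * (T / 64))) := by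
    have e : 6400 * (T / 64) = 100 * T := by ring
    rw [e, hεA]
    exact div_le_self (Real.exp_nonneg _) (by norm_num)
  have hεAle : εA ≤ 1 / 1000 := by
    rw [hεA]
    exact div_le_div_of_nonneg_right (Real.exp_le_one_iff.mpr (by linarith only [hTge]))
      (by norm_num)
  have hρ : Real.exp (8 * ((2 * q : ℕ) : ℝ) ^ 2 / n) ≤ Real.exp (8 * T) := by
    apply Real.exp_le_exp.2
    rw [div_le_iff₀ hnR]
    push_cast
    have e : (2 * (q : ℝ)) ^ 2 = 4 * (q : ℝ) ^ 2 := by ring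
    rw [e]
    linarith only [hq4]
  /- the window bound -/
  have hcore := card_support_le_window_scale F (hfact 2 F) r hn hq h256 hdq hqq_leR hLn_ltR
    hεApos hεAexp hεAle le_rfl hρ g hg hSr
  /- the budget -/
  have h2n : (0 : ℝ) < (2 : ℝ) ^ n := by positivity
  have htail : (n : ℝ) * (2 : ℝ) ^ n / (4 * (q : ℝ) ^ 2) ≤ 1 / 2500 * (2 : ℝ) ^ n := by
    rw [div_le_iff₀ (by positivity)]
    have h625 : 625 * (n : ℝ) ≤ (q : ℝ) ^ 2 := by
      linarith only [hLn_ltR, mul_nonneg (sub_nonneg.2 hTge) hnR.le]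
    linarith only [mul_le_mul_of_nonneg_right h625 h2n.le]
  have hηT : Real.exp (-(110 * (n : ℝ) / (L : ℝ) ^ 2)) = Real.exp (-(110 * T)) := by
    rw [hT, mul_div_assoc]
  rw [hηT] at hcore
  have hB := budget hTge
  rw [← hεA] at hB
  have key : 1 / 2500 * (2 : ℝ) ^ n + Real.exp (-(110 * T)) * (2 : ℝ) ^ n +
      Real.exp (-(T / 16 / 50)) * (2 : ℝ) ^ n +
      Real.exp (8 * T) / εA * (2 * (Real.exp (-(110 * T)) * (2 : ℝ) ^ n)) =
      (1 / 2500 + Real.exp (-(110 * T)) + Real.exp (-(T / 16 / 50)) +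
        Real.exp (8 * T) / εA * (2 * Real.exp (-(110 * T)))) * (2 : ℝ) ^ n := by ring
  have hfin : (1 / 2500 + Real.exp (-(110 * T)) + Real.exp (-(T / 16 / 50)) +
        Real.exp (8 * T) / εA * (2 * Real.exp (-(110 * T)))) * (2 : ℝ) ^ n ≤
      1 / 5 * (2 : ℝ) ^ n := mul_le_mul_of_nonneg_right hB h2n.le
  linarith only [hcore, htail, key, hfin]

/-- **SAL — PROVED** (`A = c_H/4`, `B = 1/100`, `κ = 110`, `n₀ = n_H`): the Sketch12 statement
`SparseAvoidLinear`, verbatim.  The cell's theorem (qa-qnc0-p1 ROUND-11 §1.4 / ask P16); engine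
[cite: Srinivasan2023, Lemma 3.1]. -/
theorem sparseAvoidLinear : SparseAvoidLinear := by
  obtain ⟨A, hA, n₀, h⟩ := card_support_le_of_sparse_class_linear
  refine ⟨A, hA, 1 / 100, by norm_num, 110, by norm_num, n₀, ?_⟩
  intro n hn L hL hLB r d hd g hg hS
  exact h (ZMod 2) n hn L hL hLB r d hd g hg hS

end Summit.QuantumAdvantage.AdviceFreeQNC0
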